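import Literature.MathematicalPhysics.QuantumFieldTheory.Balaban1983to89.B1Eq324BenfattoSect5Eq535
import Literature.MathematicalPhysics.QuantumFieldTheory.Balaban1983to89.B1Eq324BenfattoSect5Iteration
import HarnessLib

/-!
# `Balaban1983to89.B1Eq324BenfattoSect5PavementStep` — [BenfattoEtAl1978] §5 pp. 155–159, ONE FULL PAVEMENT STEP of the proof of the Basic Lemma,
# (5.9)/(5.11) → (5.13)/(5.15) → [per-box (5.16)–(5.33)] → (5.34)/(5.35), CHAINED for the tree's objects: given the per-box lower bounds as
# hypotheses (the per-box line's `…Sect5PerBox`), the left side of (4.7) for the datum `(J, I, A, b)` dominates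
# `e^{−errors + Σ_□ℓ_□}` times the left side of (4.7) for the NEXT datum `(J ∩ Γ̄₁, I, A|_{Γ̄₁}, γb)`

statement-level skeleton of published theorems with citation tags; proofs where landed; nothing here is a claim about the
Yang–Mills mass gap

WHY THIS MODULE (cell `pub-ymgap`, seat `dag-n08-d` gen 9, INTENT-31; node N08 [Balaban1985UV3]; the [BenfattoEtAl1978] source chain behind the
(α)-row `h324c`; layer 2 of the assembly census `N08-BCG-ASSEMBLY-MAP.md` v1 item (4), assembled).  Print, p. 159 (render
`lit-balaban-typer/renders/benfatto1978-cmp59/bcg_p159_s3.png`, read first-hand): *"[(5.12)] ≧ (∫P̄(dz)Π_{□∈Q^b}χ^□_{γb} exp H_{Γ̄₁})·exp{Σ_{k₁+k₂≦t,k₁>0}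
(1/k₁!k₂!) Σ_□ Ê₀^T(Ψ″₁,Ψ′₁;k₁,k₂)} exp(error) (5.35) … Now we study the integral and remark that it has the same structure as (5.12) with J replaced by Γ̄₁
and b by γb."*  The structural pieces are this seat's: (5.11) `…Sect5Eq511.abs_Hl_le_of_range`, (5.13)/(5.15) `…Sect5Eq515.integral_cutoff_exp_hatH_ge`, (5.35)
with the (5.34) error `…Sect5Eq535.exp_neg_err_mul_integral_cutoff_corridorsBar_le`, the next datum `…Sect5Iteration.cutoffBoltzmann_hamiltonian_eq_restrict`;
the per-box factors `∫ χ^{Γ₁(□)}_{γb}χ^□_b e^{Ψ_□} dP̄_ξ ≥ e^{ℓ_□}·∫ χ^{Γ₁(□)}_{γb}χ^□_b e^{Ψ′₁+Ψ₂} dP̄_ξ` are HYPOTHESES here — the shape of seat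
n08-b's `…Sect5PerBox.eq530_lower_exp` (`e^{Σ_k e₀(k)/k! − errors}·∫χe^{(Y₀+Y₂)χ} ≤ ∫χe^{Ψχ}`, `Y₀ = Ψ′₁`, `Y₂ = Ψ₂`), to be instantiated on `P̄_ξ`
by the per-box line.

WHAT IS PROVED (standard axioms; no `sorry`; no definition).
* §1 (5.9)+(5.11): `abs_cutoffBoltzmann_hamiltonian_le` (`Π_Δχ̂_Δe^{H_J}` is bounded), ★ `exp_neg_mul_integral_cutoff_hatH_le`
  (`e^{−err₅₁₁}·∫ Π_Δχ̂_Δ e^{Ĥ_J} dP̂₀ ≤ ∫ Π_Δχ̂_Δ e^{H_J} dP̂₀`, `err₅₁₁ = s₁Ab^De^{−(ϰ/4)w}|J|`).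
* §2 `measurable_integral_condField` (the conditional expectation `ξ ↦ ∫ φ dP̄_ξ` of a measurable observable is measurable in `ξ` — Fubini
  measurability through the coupling `P̄_ξ = Q ∘ (ζ ↦ u(ξ) + ζ)⁻¹`), `boxFactor_eq_setIntegral` (on the prefactor's support the box factor is the set integral `∫_{χ^□_b} e^{W} dP̄_ξ`: the corridor cut-off
  `χ^{Γ₁(□)}_{γb}(z) = χ^{Γ₁(□)}_{γb}(ξ) = 1` a.s.).
* §3 ★★★ `pavementStep` — ONE FULL STEP: for `α, β > 0`, `L ≥ 1`, `1 ≤ w`, `v ≤ w`, `γ ≤ 1 ≤ b`, `J ⊆ I`, `B ⊇` the tesserae meeting `J`, the extension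
  convention with `|A^{n}_{Δ}| ≤ A` on the range of (4.5), and per-box lower bounds `e^{ℓ_□}·G_□(ξ) ≤ F_□(ξ)` for `ξ` with `χ^{Γ₁}_{γb}(ξ) = 1`:
  `exp(−err₅₁₁ − err₅₃₄ + Σ_{□∈B}ℓ_□)·∫ cutoffBoltzmann (hamiltonian s D ϰ (A|_{Γ̄₁}) (J ∩ Γ̄₁)) I (γb) dP̂₀ ≤ ∫ cutoffBoltzmann (hamiltonian s D ϰ A J) I b dP̂₀`;
  ★★ `pavementStep_of_setIntegral` — the same with the per-box hypotheses in the set-integral form of seat n08-b's `…Sect5PerBoxOnData.perBox_condField`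
  (`e^{ℓ_□}·∫_{χ^□_b} e^{Ψ′₁+Ψ₂} dP̄_ξ ≤ ∫_{χ^□_b} e^{Ψ_□} dP̄_ξ` for `ξ` with `χ^{Γ₁}_{γb}(ξ) = 1`).
HONEST SCOPE.  The per-box bounds (hence the values of `ℓ_□`: (5.22)'s cumulants, (5.26)/(5.29)/(5.31)'s errors, (5.19)'s `W`) are hypotheses; the identification
of `Σ_□ℓ_□` accumulated over the `d + 1` steps with `[Σ_k Ê₀^T(H_J;k)/k!] ± |I|S(…)` (the statement of (4.7)), the displaced pavements and `b*` are NOT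
here; count-neutral for N08; `BasicLemmaPrinted` NOT discharged; nothing about d = 4, the continuum, OS axioms, a mass gap or the Clay problem.
-/

noncomputable section

open Finset MeasureTheory
open scoped BigOperators

namespace Literature.MathematicalPhysics.QuantumFieldTheory.Balaban1983to89.B1Eq324BenfattoSect5PavementStep

open _root_.MeasureTheory _root_.ProbabilityTheory
open Literature.MathematicalPhysics.QuantumFieldTheory.Balaban1983to89.B3Sect3VectorSelfEnergy (ZSite unitVec)
open Literature.MathematicalPhysics.QuantumFieldTheory.Balaban1983to89.B1Eq324BenfattoLemma
open Literature.MathematicalPhysics.QuantumFieldTheory.Balaban1983to89.B1Eq324BenfattoSect5Boxes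
open Literature.MathematicalPhysics.QuantumFieldTheory.Balaban1983to89.B1Eq324BenfattoSect5Eq511
open Literature.MathematicalPhysics.QuantumFieldTheory.Balaban1983to89.B1Eq324BenfattoSect5Eq524
open Literature.MathematicalPhysics.QuantumFieldTheory.Balaban1983to89.B1Eq324BenfattoSect5Eq534
open Literature.MathematicalPhysics.QuantumFieldTheory.Balaban1983to89.B1Eq324BenfattoSect5Eq515
open Literature.MathematicalPhysics.QuantumFieldTheory.Balaban1983to89.B1Eq324BenfattoSect5Eq535
open Literature.MathematicalPhysics.QuantumFieldTheory.Balaban1983to89.B1Eq324BenfattoSect5Iteration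
open Literature.MathematicalPhysics.QuantumFieldTheory.Balaban1983to89.B1Eq324BenfattoAppendixCLemma2
open Literature.MathematicalPhysics.QuantumFieldTheory.Balaban1983to89.B1Eq324BenfattoMarkov
open Literature.MathematicalPhysics.QuantumFieldTheory.Balaban1983to89.B1Eq324BenfattoSect5SlotMoments (distToRegion_eq_zero_of_mem)

variable {d : ℕ}

/-! ## §1  (5.9) + (5.11): replacing `H_J` by `Ĥ_J` costs `e^{−err₅₁₁}` -/

section Eq511

variable {α β : ℝ} {s D : ℕ} {κ : ℝ} {a : Coef d} {J I : Finset (B1Eq324BenfattoLemma.Site d)} {L w : ℕ}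
  {B : Finset (B1Eq324BenfattoLemma.Site d)} {b A : ℝ}

/-- **`Π_Δχ̂_Δ·e^{H_J}` is bounded** by `exp(s₁Ab^D|J|)` (on the small-field set `|z_Δ| ≤ b` on `J ⊆ I`). [cite: BenfattoEtAl1978, (4.7) p.152, (5.5) p.154] -/
theorem abs_cutoffBoltzmann_hamiltonian_le (hκ : 0 < κ) (hJ : CoefSupportedIn a J) (hA0 : 0 ≤ A)
    (hA : ∀ p ∈ Finset.Icc 1 s, ∀ (Δ : Fin p → B1Eq324BenfattoLemma.Site d), (∀ i, Δ i ∈ J) →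
      ∀ n ∈ admissible p D, |a p Δ n| ≤ A)
    (hJI : J ⊆ I) (hb : 1 ≤ b) (z : B1Eq324BenfattoLemma.Site d → ℝ) :
    |cutoffBoltzmann (hamiltonian s D κ a J) I b z| ≤ Real.exp (s1Const s D d κ * A * b ^ D * J.card) := by
  rw [cutoffBoltzmann]
  by_cases hz : z ∈ smallFieldSet I b
  swap
  · rw [Set.indicator_of_notMem hz, abs_zero]
    exact (Real.exp_pos _).le
  rw [Set.indicator_of_mem hz, Real.abs_exp, Real.exp_le_exp]
  have hzJ : ∀ x ∈ J, |z x| ≤ b := fun x hx => by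
    have h := hz x
    rwa [distToRegion_eq_zero_of_mem (hJI hx), add_zero, mul_one] at h
  exact (le_abs_self _).trans (abs_hamiltonian_le hκ hJ hA0 hA J hb hzJ)

/-- **(5.9) + (5.11) — `∫ Π_Δχ̂_Δ e^{H_J} dP̂₀ ≥ e^{−err₅₁₁}·∫ Π_Δχ̂_Δ e^{Ĥ_J} dP̂₀`**, `err₅₁₁ = s₁Ab^De^{−(ϰ/4)w}|J|`: on the small-field set
`H_J = Ĥ_J + H^{(l)} ≥ Ĥ_J − |H^{(l)}|` and (5.11) (`…Sect5Eq511.abs_Hl_le_of_range`; `L ≥ 1`, `B ⊇` the tesserae meeting `J`).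
[cite: BenfattoEtAl1978, (5.9), (5.11)–(5.12) p.155] -/
theorem exp_neg_mul_integral_cutoff_hatH_le (hα : 0 < α) (hβ : 0 < β) (hκ : 0 < κ) (hJ : CoefSupportedIn a J) (hA0 : 0 ≤ A)
    (hA : ∀ p ∈ Finset.Icc 1 s, ∀ (Δ : Fin p → B1Eq324BenfattoLemma.Site d), (∀ i, Δ i ∈ J) →
      ∀ n ∈ admissible p D, |a p Δ n| ≤ A)
    (hJI : J ⊆ I) (hL : 0 < L) (hB : J.image (boxIndex L) ⊆ B) (hb : 1 ≤ b) :
    Real.exp (-(s1Const s D d κ * A * b ^ D * Real.exp (-(κ / 4 * w)) * J.card)) *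
        ∫ z, cutoffBoltzmann (hatH s D κ a L w B) I b z ∂P0 d α β
      ≤ ∫ z, cutoffBoltzmann (hamiltonian s D κ a J) I b z ∂P0 d α β := by
  haveI : IsProbabilityMeasure (P0 d α β) := isProbabilityMeasure_P0 hα hβ
  rw [← integral_const_mul]
  have hint : Integrable (fun z => cutoffBoltzmann (hamiltonian s D κ a J) I b z) (P0 d α β) := by
    refine Integrable.of_bound (measurable_cutoffBoltzmann_hamiltonian a J I b).aestronglyMeasurable
      (Real.exp (s1Const s D d κ * A * b ^ D * J.card)) (ae_of_all _ fun z => ?_)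
    rw [Real.norm_eq_abs]
    exact abs_cutoffBoltzmann_hamiltonian_le hκ hJ hA0 hA hJI hb z
  refine integral_mono_of_nonneg (Filter.Eventually.of_forall fun z => mul_nonneg (Real.exp_pos _).le ?_) hint
    (Filter.Eventually.of_forall fun z => ?_)
  · rw [cutoffBoltzmann]
    exact Set.indicator_nonneg (fun _ _ => (Real.exp_pos _).le) _
  dsimp only
  simp only [cutoffBoltzmann]
  by_cases hz : z ∈ smallFieldSet I b
  swap
  · rw [Set.indicator_of_notMem hz, Set.indicator_of_notMem hz, mul_zero]
  rw [Set.indicator_of_mem hz, Set.indicator_of_mem hz, ← Real.exp_add, Real.exp_le_exp]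
  have hzJ : ∀ x ∈ J, |z x| ≤ b := fun x hx => by
    have h := hz x
    rwa [distToRegion_eq_zero_of_mem (hJI hx), add_zero, mul_one] at h
  have h511 := abs_Hl_le_of_range hκ hJ hA0 hA hL hB hb hzJ (s := s) (D := D) (w := w)
  have hsplit := hamiltonian_eq_hatH_add_Hl s D κ a J L w B z
  have := (abs_le.mp h511).1
  linarith

end Eq511

/-! ## §2  Measurability in the conditioning datum; the box factors are non-negative and bounded -/

section Factors

variable {α β : ℝ}

/-- **The conditional expectation of a measurable observable is measurable in the conditioning datum**: `ξ ↦ ∫ φ dP̄_ξ`, `P̄_ξ = condField d α β Γ ξ`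
(the coupling `z = u(ξ) + ζ`, `ζ ~ Q`, is jointly measurable; Fubini measurability). [cite: BenfattoEtAl1978, (5.13) p.155; Appendix C (C.7) p.164] -/
theorem measurable_integral_condField (hα : 0 < α) (hβ : 0 < β) (Γ : Finset (B1Eq324BenfattoLemma.Site d))
    {φ : (B1Eq324BenfattoLemma.Site d → ℝ) → ℝ} (hφ : Measurable φ) :
    Measurable fun ξ : B1Eq324BenfattoLemma.Site d → ℝ => ∫ z, φ z ∂condField d α β Γ ξ := by
  have hKc := isPosSemidefKernel_condCov_freeCov (d := d) hα hβ Γ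
  set Q := gaussianFieldOfKernel (condCov (freeCov d α β) Γ) with hQ
  haveI : IsProbabilityMeasure Q := isProbabilityMeasure_gaussianFieldOfKernel hKc
  set T : (B1Eq324BenfattoLemma.Site d → ℝ) × (B1Eq324BenfattoLemma.Site d → ℝ) → (B1Eq324BenfattoLemma.Site d → ℝ) :=
    fun p x => condMean (freeCov d α β) Γ p.1 x + p.2 x with hT
  have hum : ∀ x, Measurable fun z : B1Eq324BenfattoLemma.Site d → ℝ => condMean (freeCov d α β) Γ z x := by
    intro x
    simp only [condMean]
    refine Finset.measurable_sum _ fun c _ => Finset.measurable_sum _ fun c' _ => ?_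
    exact measurable_const.mul (measurable_pi_apply _)
  have hTm : Measurable T :=
    measurable_pi_lambda _ fun x => ((hum x).comp measurable_fst).add ((measurable_pi_apply x).comp measurable_snd)
  have heq : (fun ξ : B1Eq324BenfattoLemma.Site d → ℝ => ∫ z, φ z ∂condField d α β Γ ξ) = fun ξ => ∫ ζ, φ (T (ξ, ζ)) ∂Q := by
    funext ξ
    have hTξ : Measurable fun ζ : B1Eq324BenfattoLemma.Site d → ℝ => T (ξ, ζ) := hTm.comp (measurable_const.prodMk measurable_id)
    rw [show condField d α β Γ ξ = Q.map (fun ζ : B1Eq324BenfattoLemma.Site d → ℝ => T (ξ, ζ)) from rfl,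
      integral_map hTξ.aemeasurable hφ.aestronglyMeasurable]
  rw [heq]
  exact ((hφ.comp hTm).stronglyMeasurable.integral_prod_right' (ν := Q)).measurable

/-- The conditional expectation of an observable bounded by `C ≥ 0` is bounded by `C`. [folklore] -/
private theorem abs_integral_condField_le (hα : 0 < α) (hβ : 0 < β) (Γ : Finset (B1Eq324BenfattoLemma.Site d)) (ξ : B1Eq324BenfattoLemma.Site d → ℝ)
    {φ : (B1Eq324BenfattoLemma.Site d → ℝ) → ℝ} {C : ℝ} (hφ : ∀ z, |φ z| ≤ C) : |∫ z, φ z ∂condField d α β Γ ξ| ≤ C := by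
  haveI := isProbabilityMeasure_condField hα hβ Γ ξ
  have h := norm_integral_le_of_norm_le_const (μ := condField d α β Γ ξ) (f := φ) (C := C)
    (ae_of_all _ fun z => by rw [Real.norm_eq_abs]; exact hφ z)
  rwa [probReal_univ, mul_one, Real.norm_eq_abs] at h

variable {s D : ℕ} {κ : ℝ} {a : Coef d} {I : Finset (B1Eq324BenfattoLemma.Site d)} {L w : ℕ}
  {B : Finset (B1Eq324BenfattoLemma.Site d)} {γ b : ℝ}

/-- **On the prefactor's support the box factor is a set integral**: for `□ ∈ B`, `ξ` with `χ^{Γ₁}_{γb}(ξ) = 1` and any weight `W`,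
`∫ χ^{Γ₁(□)}_{γb}(z)χ^□_b(z)e^{W(z)} dP̄_ξ(z) = ∫_{χ^□_b} e^{W} dP̄_ξ` — under `P̄_ξ` the corridor coordinates are `ξ`'s (`…Sect5Eq515.condField_ae_eqOn`), so
`χ^{Γ₁(□)}_{γb}(z) = χ^{Γ₁(□)}_{γb}(ξ) = 1` a.s. (the form in which the per-box line states its factors). [cite: BenfattoEtAl1978, (5.13)–(5.15) p.155] -/
theorem boxFactor_eq_setIntegral (hα : 0 < α) (hβ : 0 < β) {m : B1Eq324BenfattoLemma.Site d} (hm : m ∈ B)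
    (W : (B1Eq324BenfattoLemma.Site d → ℝ) → ℝ) {ξ : B1Eq324BenfattoLemma.Site d → ℝ}
    (hξ : ξ ∈ smallFieldOn (corridors L w B : Set (B1Eq324BenfattoLemma.Site d)) I (γ * b)) :
    ∫ z, (smallFieldOn (frame1 L w m : Set (B1Eq324BenfattoLemma.Site d)) I (γ * b)).indicator (fun _ => (1 : ℝ)) z *
        (smallFieldOn (shrink L m w : Set (B1Eq324BenfattoLemma.Site d)) I b).indicator (fun _ => (1 : ℝ)) z * Real.exp (W z)
        ∂condField d α β (corridors L w B) ξ
      = ∫ z in smallFieldOn (shrink L m w : Set (B1Eq324BenfattoLemma.Site d)) I b, Real.exp (W z) ∂condField d α β (corridors L w B) ξ := by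
  have hsub : (frame1 L w m : Set (B1Eq324BenfattoLemma.Site d)) ⊆ (corridors L w B : Set (B1Eq324BenfattoLemma.Site d)) :=
    Finset.coe_subset.mpr (frame1_subset_corridors L w hm)
  have hξ1 : ξ ∈ smallFieldOn (frame1 L w m : Set (B1Eq324BenfattoLemma.Site d)) I (γ * b) := smallFieldOn_mono hsub I (γ * b) hξ
  rw [← integral_indicator (measurableSet_smallFieldOn _ I b)]
  refine integral_congr_ae ?_
  filter_upwards [condField_ae_eqOn hα hβ (corridors L w B) ξ] with z hz
  have hz1 : z ∈ smallFieldOn (frame1 L w m : Set (B1Eq324BenfattoLemma.Site d)) I (γ * b) := by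
    intro x hx
    rw [hz x (Finset.mem_coe.mp (hsub hx))]
    exact hξ1 x hx
  rw [Set.indicator_of_mem hz1, one_mul]
  by_cases hzS : z ∈ smallFieldOn (shrink L m w : Set (B1Eq324BenfattoLemma.Site d)) I b
  · rw [Set.indicator_of_mem hzS, Set.indicator_of_mem hzS, one_mul]
  · rw [Set.indicator_of_notMem hzS, Set.indicator_of_notMem hzS, zero_mul]

end Factors

/-! ## §3  One full pavement step -/

section Step

variable {α β : ℝ} {s D : ℕ} {κ : ℝ} {a : Coef d} {J I : Finset (B1Eq324BenfattoLemma.Site d)} {L w v : ℕ}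
  {B : Finset (B1Eq324BenfattoLemma.Site d)} {γ b A : ℝ}

/-- **ONE FULL PAVEMENT STEP OF THE PROOF OF THE BASIC LEMMA** — (5.9)/(5.11) → (5.13)/(5.15) → [per-box] → (5.34)/(5.35), chained: p. 155–159.
For `α, β > 0`, tesserae of side `L ≥ 1`, corridors of width `w ≥ 1`, inner corridors of width `v ≤ w`, `γ ≤ 1 ≤ b`, `J ⊆ I`, `B ⊇` the tesserae meeting
`J`, the extension convention with `|A^{n}_{Δ}| ≤ A` on the range of (4.5), and PER-BOX LOWER BOUNDS (hypotheses; the per-box line's (5.16)–(5.33) on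
`P̄_ξ`): for every `□ ∈ B` and every conditioning datum `ξ` in the prefactor's support `χ^{Γ₁}_{γb}(ξ) = 1`,
`e^{ℓ_□}·∫ χ^{Γ₁(□)}_{γb}χ^□_b e^{Ψ′₁+Ψ₂} dP̄_ξ ≤ ∫ χ^{Γ₁(□)}_{γb}χ^□_b e^{Ψ_□} dP̄_ξ` —
`exp(−err₅₁₁ − err₅₃₄ + Σ_{□∈B}ℓ_□)·∫ Π_Δχ̂^{γb}_Δ e^{H^{A|Γ̄₁}_{J∩Γ̄₁}} dP̂₀ ≤ ∫ Π_Δχ̂^{b}_Δ e^{H^A_J} dP̂₀`, with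
`err₅₁₁ = s₁Ab^De^{−(ϰ/4)w}|J|`, `err₅₃₄ = s₁Ab^D(e^{−(ϰ/4)w}|Γ̄₁| + e^{−(ϰ/4)v}|B|L^d)`: the left side of (4.7) for `(J, I, A, b)` dominates, up to the
errors and the accumulated per-box exponents, the left side of (4.7) for the next datum `(J ∩ Γ̄₁, I, A|_{Γ̄₁}, γb)` — print's «the same structure as (5.12)
with J replaced by Γ̄₁ and b by γb». [cite: BenfattoEtAl1978, §5 (5.9)–(5.15) p.155, (5.34)–(5.35) p.159] -/
theorem pavementStep (hα : 0 < α) (hβ : 0 < β) (hκ : 0 < κ) (hJ : CoefSupportedIn a J) (hA0 : 0 ≤ A)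
    (hA : ∀ p ∈ Finset.Icc 1 s, ∀ (Δ : Fin p → B1Eq324BenfattoLemma.Site d), (∀ i, Δ i ∈ J) →
      ∀ n ∈ admissible p D, |a p Δ n| ≤ A)
    (hJI : J ⊆ I) (hL : 0 < L) (hw : 1 ≤ w) (hv : v ≤ w) (hB : J.image (boxIndex L) ⊆ B) (hγ : γ ≤ 1) (hb : 1 ≤ b)
    (ℓ : B1Eq324BenfattoLemma.Site d → ℝ)
    (hbox : ∀ m ∈ B, ∀ ξ : B1Eq324BenfattoLemma.Site d → ℝ, ξ ∈ smallFieldOn (corridors L w B : Set (B1Eq324BenfattoLemma.Site d)) I (γ * b) →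
      Real.exp (ℓ m) * ∫ z, (smallFieldOn (frame1 L w m : Set (B1Eq324BenfattoLemma.Site d)) I (γ * b)).indicator (fun _ => (1 : ℝ)) z *
          (smallFieldOn (shrink L m w : Set (B1Eq324BenfattoLemma.Site d)) I b).indicator (fun _ => (1 : ℝ)) z *
          Real.exp (psi1p s D κ a L w v m z + psi2 s D κ a L w m z) ∂condField d α β (corridors L w B) ξ
        ≤ ∫ z, (smallFieldOn (frame1 L w m : Set (B1Eq324BenfattoLemma.Site d)) I (γ * b)).indicator (fun _ => (1 : ℝ)) z *
          (smallFieldOn (shrink L m w : Set (B1Eq324BenfattoLemma.Site d)) I b).indicator (fun _ => (1 : ℝ)) z *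
          Real.exp (psiBox s D κ a L w m z) ∂condField d α β (corridors L w B) ξ) :
    Real.exp (-(s1Const s D d κ * A * b ^ D * Real.exp (-(κ / 4 * w)) * J.card)
        - s1Const s D d κ * A * b ^ D *
          (Real.exp (-(κ / 4 * w)) * (corridorsBar L w v B).card + Real.exp (-(κ / 4 * v)) * (B.card * (L : ℝ) ^ d))
        + ∑ m ∈ B, ℓ m) *
        ∫ z, cutoffBoltzmann (hamiltonian s D κ (restrictCoef a (corridorsBar L w v B)) (J ∩ corridorsBar L w v B)) I (γ * b) z ∂P0 d α β
      ≤ ∫ z, cutoffBoltzmann (hamiltonian s D κ a J) I b z ∂P0 d α β := by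
  haveI : IsProbabilityMeasure (P0 d α β) := isProbabilityMeasure_P0 hα hβ
  set Γ : Finset (B1Eq324BenfattoLemma.Site d) := corridors L w B with hΓ
  set e511 : ℝ := s1Const s D d κ * A * b ^ D * Real.exp (-(κ / 4 * w)) * J.card with he511
  set e534 : ℝ := s1Const s D d κ * A * b ^ D *
    (Real.exp (-(κ / 4 * w)) * (corridorsBar L w v B).card + Real.exp (-(κ / 4 * v)) * (B.card * (L : ℝ) ^ d)) with he534
  -- the factors of the two factorised forms
  set pre : (B1Eq324BenfattoLemma.Site d → ℝ) → ℝ := fun ξ =>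
    (smallFieldOn (Γ : Set (B1Eq324BenfattoLemma.Site d)) I (γ * b)).indicator (fun _ => (1 : ℝ)) ξ * Real.exp (hamiltonian s D κ a Γ ξ) with hpre
  set OUT : (B1Eq324BenfattoLemma.Site d → ℝ) → ℝ := fun ξ =>
    ∫ z, (smallFieldOn (out L B) I b).indicator (fun _ => (1 : ℝ)) z ∂condField d α β Γ ξ with hOUT
  set F : B1Eq324BenfattoLemma.Site d → (B1Eq324BenfattoLemma.Site d → ℝ) → ℝ := fun m ξ =>
    ∫ z, (smallFieldOn (frame1 L w m : Set (B1Eq324BenfattoLemma.Site d)) I (γ * b)).indicator (fun _ => (1 : ℝ)) z *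
        (smallFieldOn (shrink L m w : Set (B1Eq324BenfattoLemma.Site d)) I b).indicator (fun _ => (1 : ℝ)) z *
        Real.exp (psiBox s D κ a L w m z) ∂condField d α β Γ ξ with hF
  set G : B1Eq324BenfattoLemma.Site d → (B1Eq324BenfattoLemma.Site d → ℝ) → ℝ := fun m ξ =>
    ∫ z, (smallFieldOn (frame1 L w m : Set (B1Eq324BenfattoLemma.Site d)) I (γ * b)).indicator (fun _ => (1 : ℝ)) z *
        (smallFieldOn (shrink L m w : Set (B1Eq324BenfattoLemma.Site d)) I b).indicator (fun _ => (1 : ℝ)) z *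
        Real.exp (psi1p s D κ a L w v m z + psi2 s D κ a L w m z) ∂condField d α β Γ ξ with hG
  -- step 1: (5.11)
  have h1 := exp_neg_mul_integral_cutoff_hatH_le hα hβ hκ hJ hA0 hA hJI hL hB hb (s := s) (D := D) (w := w) (I := I)
  -- step 2: (5.13) + (5.15)
  have h2 : ∫ ξ, pre ξ * (OUT ξ * ∏ m ∈ B, F m ξ) ∂P0 d α β ≤ ∫ z, cutoffBoltzmann (hatH s D κ a L w B) I b z ∂P0 d α β :=
    integral_cutoff_exp_hatH_ge hα hβ hκ hJ hA0 hA hJI hL hw B hγ hb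
  -- step 3: the per-box lower bounds, inside the ξ-integral
  have hpre0 : ∀ ξ, 0 ≤ pre ξ := fun ξ => mul_nonneg (indicator_smallFieldOn_mem_Icc _ I _ ξ).1 (Real.exp_pos _).le
  have hOUT0 : ∀ ξ, 0 ≤ OUT ξ := fun ξ => integral_nonneg fun z => (indicator_smallFieldOn_mem_Icc _ I b z).1
  have hOUT1 : ∀ ξ, OUT ξ ≤ 1 := fun ξ => by
    have h := abs_integral_condField_le hα hβ Γ ξ (φ := fun z => (smallFieldOn (out L B) I b).indicator (fun _ => (1 : ℝ)) z) (C := 1)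
      fun z => by rw [abs_of_nonneg (indicator_smallFieldOn_mem_Icc _ I b z).1]; exact (indicator_smallFieldOn_mem_Icc _ I b z).2
    exact (le_abs_self _).trans h
  have hboxObs0 : ∀ (m : B1Eq324BenfattoLemma.Site d) (W : (B1Eq324BenfattoLemma.Site d → ℝ) → ℝ) (z : B1Eq324BenfattoLemma.Site d → ℝ),
      0 ≤ (smallFieldOn (frame1 L w m : Set (B1Eq324BenfattoLemma.Site d)) I (γ * b)).indicator (fun _ => (1 : ℝ)) z *
        (smallFieldOn (shrink L m w : Set (B1Eq324BenfattoLemma.Site d)) I b).indicator (fun _ => (1 : ℝ)) z * Real.exp (W z) := fun m W z =>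
    mul_nonneg (mul_nonneg (indicator_smallFieldOn_mem_Icc _ I _ z).1 (indicator_smallFieldOn_mem_Icc _ I _ z).1) (Real.exp_pos _).le
  have hG0 : ∀ m ξ, 0 ≤ G m ξ := fun m ξ =>
    integral_nonneg fun z => hboxObs0 m (fun z => psi1p s D κ a L w v m z + psi2 s D κ a L w m z) z
  have hF0 : ∀ m ξ, 0 ≤ F m ξ := fun m ξ => integral_nonneg fun z => hboxObs0 m (fun z => psiBox s D κ a L w m z) z
  have hKF : ∀ m ξ, |F m ξ| ≤ Real.exp (2 * s1Const s D d κ * A * b ^ D * (L : ℝ) ^ d) := fun m ξ =>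
    abs_integral_condField_le hα hβ Γ ξ fun z =>
      abs_boxObs_le hJI hγ (zero_le_one.trans hb) m (fun z hz => abs_psiBox_le_local hκ hJ hA0 hA hb hz) z
  have h3pt : ∀ ξ, Real.exp (∑ m ∈ B, ℓ m) * (pre ξ * (OUT ξ * ∏ m ∈ B, G m ξ)) ≤ pre ξ * (OUT ξ * ∏ m ∈ B, F m ξ) := by
    intro ξ
    by_cases hξ : ξ ∈ smallFieldOn (Γ : Set (B1Eq324BenfattoLemma.Site d)) I (γ * b)
    swap
    · -- off the prefactor's support both sides vanish
      have hpre : pre ξ = 0 := by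
        simp only [hpre]
        rw [Set.indicator_of_notMem hξ, zero_mul]
      rw [hpre, zero_mul, zero_mul, mul_zero]
    rw [Real.exp_sum]
    have hprod : (∏ m ∈ B, Real.exp (ℓ m)) * ∏ m ∈ B, G m ξ ≤ ∏ m ∈ B, F m ξ := by
      rw [← Finset.prod_mul_distrib]
      exact Finset.prod_le_prod (fun m _ => mul_nonneg (Real.exp_pos _).le (hG0 m ξ)) fun m hm => hbox m hm ξ hξ
    calc (∏ m ∈ B, Real.exp (ℓ m)) * (pre ξ * (OUT ξ * ∏ m ∈ B, G m ξ))
        = pre ξ * (OUT ξ * ((∏ m ∈ B, Real.exp (ℓ m)) * ∏ m ∈ B, G m ξ)) := by ring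
      _ ≤ pre ξ * (OUT ξ * ∏ m ∈ B, F m ξ) :=
        mul_le_mul_of_nonneg_left (mul_le_mul_of_nonneg_left hprod (hOUT0 ξ)) (hpre0 ξ)
  -- integrability of the (5.15) factorised ξ-integrand: bounded and measurable
  have hmeas : Measurable fun ξ => pre ξ * (OUT ξ * ∏ m ∈ B, F m ξ) := by
    refine ((measurable_indicator_smallFieldOn _ I (γ * b)).mul (measurable_hamiltonian Γ).exp).mul
      ((measurable_integral_condField hα hβ Γ (measurable_indicator_smallFieldOn _ I b)).mul (Finset.measurable_prod _ fun m _ => ?_))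
    exact measurable_integral_condField hα hβ Γ
      (((measurable_indicator_smallFieldOn _ I (γ * b)).mul (measurable_indicator_smallFieldOn _ I b)).mul (measurable_psiBox L w m).exp)
  have hint : Integrable (fun ξ => pre ξ * (OUT ξ * ∏ m ∈ B, F m ξ)) (P0 d α β) := by
    refine Integrable.of_bound hmeas.aestronglyMeasurable
      (Real.exp (s1Const s D d κ * A * b ^ D * Γ.card) * (1 * ∏ _m ∈ B, Real.exp (2 * s1Const s D d κ * A * b ^ D * (L : ℝ) ^ d)))
      (ae_of_all _ fun ξ => ?_)
    rw [Real.norm_eq_abs]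
    have hp : |pre ξ| ≤ Real.exp (s1Const s D d κ * A * b ^ D * Γ.card) := abs_corridorObs_le hκ hJ hA0 hA hJI hγ hb Γ ξ
    have hrest : |OUT ξ * ∏ m ∈ B, F m ξ| ≤ 1 * ∏ _m ∈ B, Real.exp (2 * s1Const s D d κ * A * b ^ D * (L : ℝ) ^ d) := by
      rw [abs_mul, Finset.abs_prod, abs_of_nonneg (hOUT0 ξ)]
      exact mul_le_mul (hOUT1 ξ) (Finset.prod_le_prod (fun m _ => abs_nonneg _) fun m _ => hKF m ξ)
        (Finset.prod_nonneg fun m _ => abs_nonneg _) zero_le_one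
    calc |pre ξ * (OUT ξ * ∏ m ∈ B, F m ξ)| = |pre ξ| * |OUT ξ * ∏ m ∈ B, F m ξ| := abs_mul _ _
      _ ≤ _ := mul_le_mul hp hrest (abs_nonneg _) (Real.exp_pos _).le
  have h3 : Real.exp (∑ m ∈ B, ℓ m) * ∫ ξ, pre ξ * (OUT ξ * ∏ m ∈ B, G m ξ) ∂P0 d α β
      ≤ ∫ ξ, pre ξ * (OUT ξ * ∏ m ∈ B, F m ξ) ∂P0 d α β := by
    rw [← integral_const_mul]
    exact integral_mono_of_nonneg (Filter.Eventually.of_forall fun ξ => mul_nonneg (Real.exp_pos _).le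
      (mul_nonneg (hpre0 ξ) (mul_nonneg (hOUT0 ξ) (Finset.prod_nonneg fun m _ => hG0 m ξ)))) hint
      (Filter.Eventually.of_forall h3pt)
  -- step 4: (5.35) with the (5.34) error
  have h4 : Real.exp (-e534) * ∫ z, cutoffBoltzmann (hamiltonian s D κ a (corridorsBar L w v B)) I (γ * b) z ∂P0 d α β
      ≤ ∫ ξ, pre ξ * (OUT ξ * ∏ m ∈ B, G m ξ) ∂P0 d α β :=
    exp_neg_err_mul_integral_cutoff_corridorsBar_le hα hβ hκ hJ hA0 hA hJI hL hw hv B hγ hb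
  -- step 5: the next datum
  have h5 : ∫ z, cutoffBoltzmann (hamiltonian s D κ a (corridorsBar L w v B)) I (γ * b) z ∂P0 d α β
      = ∫ z, cutoffBoltzmann (hamiltonian s D κ (restrictCoef a (corridorsBar L w v B)) (J ∩ corridorsBar L w v B)) I (γ * b) z ∂P0 d α β :=
    integral_congr_ae (Filter.Eventually.of_forall fun z => cutoffBoltzmann_hamiltonian_eq_restrict hJ _ I (γ * b) z)
  -- chain
  have hZ0 : 0 ≤ ∫ z, cutoffBoltzmann (hamiltonian s D κ a (corridorsBar L w v B)) I (γ * b) z ∂P0 d α β :=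
    integral_nonneg fun z => by
      rw [cutoffBoltzmann]
      exact Set.indicator_nonneg (fun _ _ => (Real.exp_pos _).le) _
  rw [← h5]
  calc Real.exp (-e511 - e534 + ∑ m ∈ B, ℓ m) * ∫ z, cutoffBoltzmann (hamiltonian s D κ a (corridorsBar L w v B)) I (γ * b) z ∂P0 d α β
      = Real.exp (-e511) * (Real.exp (∑ m ∈ B, ℓ m) *
          (Real.exp (-e534) * ∫ z, cutoffBoltzmann (hamiltonian s D κ a (corridorsBar L w v B)) I (γ * b) z ∂P0 d α β)) := by
        rw [show -e511 - e534 + ∑ m ∈ B, ℓ m = -e511 + (∑ m ∈ B, ℓ m + -e534) by ring, Real.exp_add, Real.exp_add]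
        ring
    _ ≤ Real.exp (-e511) * (Real.exp (∑ m ∈ B, ℓ m) * ∫ ξ, pre ξ * (OUT ξ * ∏ m ∈ B, G m ξ) ∂P0 d α β) :=
        mul_le_mul_of_nonneg_left (mul_le_mul_of_nonneg_left h4 (Real.exp_pos _).le) (Real.exp_pos _).le
    _ ≤ Real.exp (-e511) * ∫ ξ, pre ξ * (OUT ξ * ∏ m ∈ B, F m ξ) ∂P0 d α β := mul_le_mul_of_nonneg_left h3 (Real.exp_pos _).le
    _ ≤ Real.exp (-e511) * ∫ z, cutoffBoltzmann (hatH s D κ a L w B) I b z ∂P0 d α β := mul_le_mul_of_nonneg_left h2 (Real.exp_pos _).le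
    _ ≤ _ := h1

/-- **ONE FULL PAVEMENT STEP, with the per-box hypotheses in SET-INTEGRAL FORM** (the shape of the per-box line's `perBox_condField`:
`e^{ℓ_□}·∫_{χ^□_b} e^{Ψ′₁+Ψ₂} dP̄_ξ ≤ ∫_{χ^□_b} e^{Ψ_□} dP̄_ξ` for every `□ ∈ B` and every `ξ` with `χ^{Γ₁}_{γb}(ξ) = 1`); conclusion as in `pavementStep`.
[cite: BenfattoEtAl1978, §5 (5.9)–(5.15) p.155, (5.30)–(5.35) p.158–159] -/
theorem pavementStep_of_setIntegral (hα : 0 < α) (hβ : 0 < β) (hκ : 0 < κ) (hJ : CoefSupportedIn a J) (hA0 : 0 ≤ A)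
    (hA : ∀ p ∈ Finset.Icc 1 s, ∀ (Δ : Fin p → B1Eq324BenfattoLemma.Site d), (∀ i, Δ i ∈ J) →
      ∀ n ∈ admissible p D, |a p Δ n| ≤ A)
    (hJI : J ⊆ I) (hL : 0 < L) (hw : 1 ≤ w) (hv : v ≤ w) (hB : J.image (boxIndex L) ⊆ B) (hγ : γ ≤ 1) (hb : 1 ≤ b)
    (ℓ : B1Eq324BenfattoLemma.Site d → ℝ)
    (hbox : ∀ m ∈ B, ∀ ξ : B1Eq324BenfattoLemma.Site d → ℝ, ξ ∈ smallFieldOn (corridors L w B : Set (B1Eq324BenfattoLemma.Site d)) I (γ * b) →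
      Real.exp (ℓ m) * ∫ z in smallFieldOn (shrink L m w : Set (B1Eq324BenfattoLemma.Site d)) I b,
          Real.exp (psi1p s D κ a L w v m z + psi2 s D κ a L w m z) ∂condField d α β (corridors L w B) ξ
        ≤ ∫ z in smallFieldOn (shrink L m w : Set (B1Eq324BenfattoLemma.Site d)) I b,
          Real.exp (psiBox s D κ a L w m z) ∂condField d α β (corridors L w B) ξ) :
    Real.exp (-(s1Const s D d κ * A * b ^ D * Real.exp (-(κ / 4 * w)) * J.card)
        - s1Const s D d κ * A * b ^ D *
          (Real.exp (-(κ / 4 * w)) * (corridorsBar L w v B).card + Real.exp (-(κ / 4 * v)) * (B.card * (L : ℝ) ^ d))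
        + ∑ m ∈ B, ℓ m) *
        ∫ z, cutoffBoltzmann (hamiltonian s D κ (restrictCoef a (corridorsBar L w v B)) (J ∩ corridorsBar L w v B)) I (γ * b) z ∂P0 d α β
      ≤ ∫ z, cutoffBoltzmann (hamiltonian s D κ a J) I b z ∂P0 d α β := by
  refine pavementStep hα hβ hκ hJ hA0 hA hJI hL hw hv hB hγ hb ℓ fun m hm ξ hξ => ?_
  rw [boxFactor_eq_setIntegral hα hβ hm _ hξ, boxFactor_eq_setIntegral hα hβ hm _ hξ]
  exact hbox m hm ξ hξ

end Step

/-! ## §4  The upper twin at `C = ∅` ((5.36) → «the r.h.s. of (5.35) with b replaced by γ⁻¹b»): one full step, reversed -/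

section Upper

variable {α β : ℝ} {s D : ℕ} {κ : ℝ} {a : Coef d} {J I : Finset (B1Eq324BenfattoLemma.Site d)} {L w v : ℕ}
  {B : Finset (B1Eq324BenfattoLemma.Site d)} {b A : ℝ}

/-- **On `Π_Δχ̂^b_Δ` every regional cut-off at threshold `b` is `1`**: the product of the (5.13) cut-offs at `γ = 1` dominates `1_{SF(I,b)}` (with §1 of
`…Sect5Eq515` the two are equal). [cite: BenfattoEtAl1978, (5.14) p.155, (5.36) p.159] -/
theorem indicator_smallFieldSet_le_prod (L w : ℕ) (B : Finset (B1Eq324BenfattoLemma.Site d)) (I : Finset (B1Eq324BenfattoLemma.Site d)) (b : ℝ)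
    (z : B1Eq324BenfattoLemma.Site d → ℝ) :
    (smallFieldSet I b).indicator (fun _ => (1 : ℝ)) z ≤
      (smallFieldOn (corridors L w B : Set (B1Eq324BenfattoLemma.Site d)) I (1 * b)).indicator (fun _ => (1 : ℝ)) z *
        ((smallFieldOn (out L B) I b).indicator (fun _ => (1 : ℝ)) z *
          ∏ m ∈ B, ((smallFieldOn (frame1 L w m : Set (B1Eq324BenfattoLemma.Site d)) I (1 * b)).indicator (fun _ => (1 : ℝ)) z *
              (smallFieldOn (shrink L m w : Set (B1Eq324BenfattoLemma.Site d)) I b).indicator (fun _ => (1 : ℝ)) z)) := by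
  by_cases hz : z ∈ smallFieldSet I b
  · have h1 : ∀ R : Set (B1Eq324BenfattoLemma.Site d), z ∈ smallFieldOn R I (1 * b) := fun R =>
      mem_smallFieldOn_of_mem_smallFieldSet (by rw [one_mul]) hz
    have h2 : ∀ R : Set (B1Eq324BenfattoLemma.Site d), z ∈ smallFieldOn R I b := fun R => mem_smallFieldOn_of_mem_smallFieldSet le_rfl hz
    rw [Set.indicator_of_mem hz, Set.indicator_of_mem (h1 _), Set.indicator_of_mem (h2 _), one_mul, one_mul]
    rw [Finset.prod_eq_one fun m _ => by rw [Set.indicator_of_mem (h1 _), Set.indicator_of_mem (h2 _), one_mul]]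
  · rw [Set.indicator_of_notMem hz]
    refine mul_nonneg (indicator_smallFieldOn_mem_Icc _ I _ z).1 (mul_nonneg (indicator_smallFieldOn_mem_Icc _ I _ z).1
      (Finset.prod_nonneg fun m _ => mul_nonneg (indicator_smallFieldOn_mem_Icc _ I _ z).1 (indicator_smallFieldOn_mem_Icc _ I _ z).1))

/-- **THE UPPER TWIN OF ONE PAVEMENT STEP at `C = ∅`** — p. 159, *"[(5.12)] ≦ ∫P̄(dz_{Γ₁})χ^{Γ₁}_b exp H_{Γ₁}(Π_{□∩J=∅}∫P̄(dz_□|z_{Γ₁})χ^□_b)·(Π_{□∩J≠∅}∫P̄(dz_□|z_{Γ₁})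
exp Ψ_□χ^□_b) (5.36) By beeing careful in attributing to the various τ the value opposite to the one chosen in the estimate (4.7) we obtain that (5.12) can be
bounded above by the r.h.s. of (5.35) with b replaced by γ⁻¹b"*.  PROVED for the tree's objects at `P̄ = P̂₀` (no conditioning set): with per-box UPPER
bounds as hypotheses (the shape of the per-box line's `eq536_upper_exp` / the 5th conjunct of `perBox_condField`: `∫_{χ^□_b}e^{Ψ_□}dP̄_ξ ≤ e^{u_□}·
∫_{χ^□_b}e^{Ψ′₁+Ψ₂}dP̄_ξ` for `ξ` with `χ^{Γ₁}_b(ξ) = 1`), all cut-offs at threshold `b` (`γ = 1`):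
`∫ Π_Δχ̂^b_Δ e^{H^A_J} dP̂₀ ≤ exp(err₅₁₁ + err₅₃₄ + Σ_{□∈B}u_□)·∫ Π_Δχ̂^b_Δ e^{H^{A|Γ̄₁}_{J∩Γ̄₁}} dP̂₀` — the same chain read with the opposite signs
((5.11), the factorisation identity at `γ = 1`, (5.34)). [cite: BenfattoEtAl1978, §5 (5.36) p.159, (4.6) p.152] -/
theorem upperPavementStep_of_setIntegral (hα : 0 < α) (hβ : 0 < β) (hκ : 0 < κ) (hJ : CoefSupportedIn a J) (hA0 : 0 ≤ A)
    (hA : ∀ p ∈ Finset.Icc 1 s, ∀ (Δ : Fin p → B1Eq324BenfattoLemma.Site d), (∀ i, Δ i ∈ J) →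
      ∀ n ∈ admissible p D, |a p Δ n| ≤ A)
    (hJI : J ⊆ I) (hL : 0 < L) (hw : 1 ≤ w) (hv : v ≤ w) (hB : J.image (boxIndex L) ⊆ B) (hb : 1 ≤ b)
    (u : B1Eq324BenfattoLemma.Site d → ℝ)
    (hbox : ∀ m ∈ B, ∀ ξ : B1Eq324BenfattoLemma.Site d → ℝ, ξ ∈ smallFieldOn (corridors L w B : Set (B1Eq324BenfattoLemma.Site d)) I (1 * b) →
      ∫ z in smallFieldOn (shrink L m w : Set (B1Eq324BenfattoLemma.Site d)) I b,
          Real.exp (psiBox s D κ a L w m z) ∂condField d α β (corridors L w B) ξ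
        ≤ Real.exp (u m) * ∫ z in smallFieldOn (shrink L m w : Set (B1Eq324BenfattoLemma.Site d)) I b,
          Real.exp (psi1p s D κ a L w v m z + psi2 s D κ a L w m z) ∂condField d α β (corridors L w B) ξ) :
    ∫ z, cutoffBoltzmann (hamiltonian s D κ a J) I b z ∂P0 d α β ≤
      Real.exp (s1Const s D d κ * A * b ^ D * Real.exp (-(κ / 4 * w)) * J.card
        + s1Const s D d κ * A * b ^ D *
          (Real.exp (-(κ / 4 * w)) * (corridorsBar L w v B).card + Real.exp (-(κ / 4 * v)) * (B.card * (L : ℝ) ^ d))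
        + ∑ m ∈ B, u m) *
        ∫ z, cutoffBoltzmann (hamiltonian s D κ (restrictCoef a (corridorsBar L w v B)) (J ∩ corridorsBar L w v B)) I b z ∂P0 d α β := by
  haveI : IsProbabilityMeasure (P0 d α β) := isProbabilityMeasure_P0 hα hβ
  set Γ : Finset (B1Eq324BenfattoLemma.Site d) := corridors L w B with hΓ
  set e511 : ℝ := s1Const s D d κ * A * b ^ D * Real.exp (-(κ / 4 * w)) * J.card with he511
  set e534 : ℝ := s1Const s D d κ * A * b ^ D *
    (Real.exp (-(κ / 4 * w)) * (corridorsBar L w v B).card + Real.exp (-(κ / 4 * v)) * (B.card * (L : ℝ) ^ d)) with he534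
  have h1b : (1 : ℝ) ≤ 1 := le_rfl
  -- the two factorised z-integrands at `γ = 1`
  set IF : (B1Eq324BenfattoLemma.Site d → ℝ) → ℝ := fun z =>
    (smallFieldOn (Γ : Set (B1Eq324BenfattoLemma.Site d)) I (1 * b)).indicator (fun _ => (1 : ℝ)) z * Real.exp (hamiltonian s D κ a Γ z) *
      ((smallFieldOn (out L B) I b).indicator (fun _ => (1 : ℝ)) z *
        ∏ m ∈ B, (smallFieldOn (frame1 L w m : Set (B1Eq324BenfattoLemma.Site d)) I (1 * b)).indicator (fun _ => (1 : ℝ)) z *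
            (smallFieldOn (shrink L m w : Set (B1Eq324BenfattoLemma.Site d)) I b).indicator (fun _ => (1 : ℝ)) z * Real.exp (psiBox s D κ a L w m z))
    with hIF
  set IG : (B1Eq324BenfattoLemma.Site d → ℝ) → ℝ := fun z =>
    (smallFieldOn (Γ : Set (B1Eq324BenfattoLemma.Site d)) I (1 * b)).indicator (fun _ => (1 : ℝ)) z * Real.exp (hamiltonian s D κ a Γ z) *
      ((smallFieldOn (out L B) I b).indicator (fun _ => (1 : ℝ)) z *
        ∏ m ∈ B, (smallFieldOn (frame1 L w m : Set (B1Eq324BenfattoLemma.Site d)) I (1 * b)).indicator (fun _ => (1 : ℝ)) z *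
            (smallFieldOn (shrink L m w : Set (B1Eq324BenfattoLemma.Site d)) I b).indicator (fun _ => (1 : ℝ)) z *
            Real.exp (psi1p s D κ a L w v m z + psi2 s D κ a L w m z))
    with hIG
  -- the ξ-side factors
  set pre : (B1Eq324BenfattoLemma.Site d → ℝ) → ℝ := fun ξ =>
    (smallFieldOn (Γ : Set (B1Eq324BenfattoLemma.Site d)) I (1 * b)).indicator (fun _ => (1 : ℝ)) ξ * Real.exp (hamiltonian s D κ a Γ ξ) with hpre
  set OUT : (B1Eq324BenfattoLemma.Site d → ℝ) → ℝ := fun ξ =>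
    ∫ z, (smallFieldOn (out L B) I b).indicator (fun _ => (1 : ℝ)) z ∂condField d α β Γ ξ with hOUT
  set F : B1Eq324BenfattoLemma.Site d → (B1Eq324BenfattoLemma.Site d → ℝ) → ℝ := fun m ξ =>
    ∫ z, (smallFieldOn (frame1 L w m : Set (B1Eq324BenfattoLemma.Site d)) I (1 * b)).indicator (fun _ => (1 : ℝ)) z *
        (smallFieldOn (shrink L m w : Set (B1Eq324BenfattoLemma.Site d)) I b).indicator (fun _ => (1 : ℝ)) z *
        Real.exp (psiBox s D κ a L w m z) ∂condField d α β Γ ξ with hF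
  set G : B1Eq324BenfattoLemma.Site d → (B1Eq324BenfattoLemma.Site d → ℝ) → ℝ := fun m ξ =>
    ∫ z, (smallFieldOn (frame1 L w m : Set (B1Eq324BenfattoLemma.Site d)) I (1 * b)).indicator (fun _ => (1 : ℝ)) z *
        (smallFieldOn (shrink L m w : Set (B1Eq324BenfattoLemma.Site d)) I b).indicator (fun _ => (1 : ℝ)) z *
        Real.exp (psi1p s D κ a L w v m z + psi2 s D κ a L w m z) ∂condField d α β Γ ξ with hG
  have hWbF : ∀ m, ∀ z : B1Eq324BenfattoLemma.Site d → ℝ, (∀ x ∈ J, x ∈ box L m → |z x| ≤ b) →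
      |psiBox s D κ a L w m z| ≤ 2 * s1Const s D d κ * A * b ^ D * (L : ℝ) ^ d := fun m z hz => abs_psiBox_le_local hκ hJ hA0 hA hb hz
  have hWbG : ∀ m, ∀ z : B1Eq324BenfattoLemma.Site d → ℝ, (∀ x ∈ J, x ∈ box L m → |z x| ≤ b) →
      |psi1p s D κ a L w v m z + psi2 s D κ a L w m z| ≤ 8 * (s1Const s D d κ * A * b ^ D * (L : ℝ) ^ d) :=
    fun m z hz => abs_psi1p_add_psi2_le_local hκ hJ hA0 hA hb hz
  -- |z| ≤ b on J on the small-field set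
  have hzJ : ∀ z ∈ smallFieldSet I b, ∀ x ∈ J, |z x| ≤ b := fun z hz x hx => by
    have h := hz x
    rwa [distToRegion_eq_zero_of_mem (hJI hx), add_zero, mul_one] at h
  -- U1: (5.11) upwards
  have hU1pt : ∀ z, cutoffBoltzmann (hamiltonian s D κ a J) I b z ≤ Real.exp e511 * cutoffBoltzmann (hatH s D κ a L w B) I b z := by
    intro z
    simp only [cutoffBoltzmann]
    by_cases hz : z ∈ smallFieldSet I b
    · rw [Set.indicator_of_mem hz, Set.indicator_of_mem hz, ← Real.exp_add, Real.exp_le_exp]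
      have h511 := abs_Hl_le_of_range hκ hJ hA0 hA hL hB hb (hzJ z hz) (s := s) (D := D) (w := w)
      have hsplit := hamiltonian_eq_hatH_add_Hl s D κ a J L w B z
      have := (abs_le.mp h511).2
      linarith
    · rw [Set.indicator_of_notMem hz, Set.indicator_of_notMem hz, mul_zero]
  -- U2: the factorised form at `γ = 1` dominates `Π_Δχ̂_Δ e^{Ĥ}` pointwise
  have hU2pt : ∀ z, cutoffBoltzmann (hatH s D κ a L w B) I b z ≤ IF z := by
    intro z
    have hF' : cutoffBoltzmann (hatH s D κ a L w B) I b z = (smallFieldSet I b).indicator (fun _ => (1 : ℝ)) z * Real.exp (hatH s D κ a L w B z) := by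
      rw [cutoffBoltzmann]
      by_cases hz : z ∈ smallFieldSet I b
      · rw [Set.indicator_of_mem hz, Set.indicator_of_mem hz, one_mul]
      · rw [Set.indicator_of_notMem hz, Set.indicator_of_notMem hz, zero_mul]
    have hIFeq : IF z = ((smallFieldOn (Γ : Set (B1Eq324BenfattoLemma.Site d)) I (1 * b)).indicator (fun _ => (1 : ℝ)) z *
        ((smallFieldOn (out L B) I b).indicator (fun _ => (1 : ℝ)) z *
          ∏ m ∈ B, ((smallFieldOn (frame1 L w m : Set (B1Eq324BenfattoLemma.Site d)) I (1 * b)).indicator (fun _ => (1 : ℝ)) z *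
              (smallFieldOn (shrink L m w : Set (B1Eq324BenfattoLemma.Site d)) I b).indicator (fun _ => (1 : ℝ)) z))) *
        (Real.exp (hamiltonian s D κ a Γ z) * ∏ m ∈ B, Real.exp (psiBox s D κ a L w m z)) := by
      simp only [hIF]
      rw [Finset.prod_mul_distrib]
      ring
    rw [hF', hIFeq, exp_hatH_eq]
    exact mul_le_mul_of_nonneg_right (indicator_smallFieldSet_le_prod L w B I b z)
      (mul_nonneg (Real.exp_pos _).le (Finset.prod_nonneg fun m _ => (Real.exp_pos _).le))
  have hIFint : Integrable IF (P0 d α β) :=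
    integrable_boxes_integrand hα hβ hκ hJ hA0 hA hJI B h1b hb (fun m z => psiBox s D κ a L w m z) (fun m => measurable_psiBox L w m) hWbF
  have hU12 : ∫ z, cutoffBoltzmann (hamiltonian s D κ a J) I b z ∂P0 d α β ≤ Real.exp e511 * ∫ z, IF z ∂P0 d α β := by
    rw [← integral_const_mul]
    refine integral_mono_of_nonneg (Filter.Eventually.of_forall fun z => ?_) (hIFint.const_mul _)
      (Filter.Eventually.of_forall fun z => (hU1pt z).trans (mul_le_mul_of_nonneg_left (hU2pt z) (Real.exp_pos _).le))
    rw [cutoffBoltzmann]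
    exact Set.indicator_nonneg (fun _ _ => (Real.exp_pos _).le) _
  -- the factorisation identity, forwards and backwards (γ = 1)
  have hfacF : ∫ z, IF z ∂P0 d α β = ∫ ξ, pre ξ * (OUT ξ * ∏ m ∈ B, F m ξ) ∂P0 d α β :=
    integral_boxes_factorise_eq hα hβ hκ hJ hA0 hA hJI hL hw B h1b hb (fun m z => psiBox s D κ a L w m z)
      (fun m z z' h => psiBox_congr_eqOn L w m h) (fun m => measurable_psiBox L w m) hWbF
  have hfacG : ∫ z, IG z ∂P0 d α β = ∫ ξ, pre ξ * (OUT ξ * ∏ m ∈ B, G m ξ) ∂P0 d α β :=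
    integral_boxes_factorise_eq hα hβ hκ hJ hA0 hA hJI hL hw B h1b hb (fun m z => psi1p s D κ a L w v m z + psi2 s D κ a L w m z)
      (fun m z z' h => psi1p_add_psi2_congr_eqOn L w v m h) (fun m => measurable_psi1p_add_psi2 L w v m) hWbG
  -- U3: the per-box upper bounds inside the ξ-integral
  have hpre0 : ∀ ξ, 0 ≤ pre ξ := fun ξ => mul_nonneg (indicator_smallFieldOn_mem_Icc _ I _ ξ).1 (Real.exp_pos _).le
  have hOUT0 : ∀ ξ, 0 ≤ OUT ξ := fun ξ => integral_nonneg fun z => (indicator_smallFieldOn_mem_Icc _ I b z).1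
  have hOUT1 : ∀ ξ, OUT ξ ≤ 1 := fun ξ => by
    have h := abs_integral_condField_le hα hβ Γ ξ (φ := fun z => (smallFieldOn (out L B) I b).indicator (fun _ => (1 : ℝ)) z) (C := 1)
      fun z => by rw [abs_of_nonneg (indicator_smallFieldOn_mem_Icc _ I b z).1]; exact (indicator_smallFieldOn_mem_Icc _ I b z).2
    exact (le_abs_self _).trans h
  have hboxObs0 : ∀ (m : B1Eq324BenfattoLemma.Site d) (W : (B1Eq324BenfattoLemma.Site d → ℝ) → ℝ) (z : B1Eq324BenfattoLemma.Site d → ℝ),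
      0 ≤ (smallFieldOn (frame1 L w m : Set (B1Eq324BenfattoLemma.Site d)) I (1 * b)).indicator (fun _ => (1 : ℝ)) z *
        (smallFieldOn (shrink L m w : Set (B1Eq324BenfattoLemma.Site d)) I b).indicator (fun _ => (1 : ℝ)) z * Real.exp (W z) := fun m W z =>
    mul_nonneg (mul_nonneg (indicator_smallFieldOn_mem_Icc _ I _ z).1 (indicator_smallFieldOn_mem_Icc _ I _ z).1) (Real.exp_pos _).le
  have hG0 : ∀ m ξ, 0 ≤ G m ξ := fun m ξ =>
    integral_nonneg fun z => hboxObs0 m (fun z => psi1p s D κ a L w v m z + psi2 s D κ a L w m z) z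
  have hF0 : ∀ m ξ, 0 ≤ F m ξ := fun m ξ => integral_nonneg fun z => hboxObs0 m (fun z => psiBox s D κ a L w m z) z
  have hKG : ∀ m ξ, |G m ξ| ≤ Real.exp (8 * (s1Const s D d κ * A * b ^ D * (L : ℝ) ^ d)) := fun m ξ =>
    abs_integral_condField_le hα hβ Γ ξ fun z => abs_boxObs_le hJI h1b (zero_le_one.trans hb) m (hWbG m) z
  have hbox' : ∀ m ∈ B, ∀ ξ, ξ ∈ smallFieldOn (Γ : Set (B1Eq324BenfattoLemma.Site d)) I (1 * b) → F m ξ ≤ Real.exp (u m) * G m ξ := by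
    intro m hm ξ hξ
    simp only [hF, hG]
    rw [boxFactor_eq_setIntegral hα hβ hm _ hξ, boxFactor_eq_setIntegral hα hβ hm _ hξ]
    exact hbox m hm ξ hξ
  have h3pt : ∀ ξ, pre ξ * (OUT ξ * ∏ m ∈ B, F m ξ) ≤ Real.exp (∑ m ∈ B, u m) * (pre ξ * (OUT ξ * ∏ m ∈ B, G m ξ)) := by
    intro ξ
    by_cases hξ : ξ ∈ smallFieldOn (Γ : Set (B1Eq324BenfattoLemma.Site d)) I (1 * b)
    swap
    · have hpre' : pre ξ = 0 := by
        simp only [hpre]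
        rw [Set.indicator_of_notMem hξ, zero_mul]
      rw [hpre', zero_mul, zero_mul, mul_zero]
    rw [Real.exp_sum]
    have hprod : ∏ m ∈ B, F m ξ ≤ (∏ m ∈ B, Real.exp (u m)) * ∏ m ∈ B, G m ξ := by
      rw [← Finset.prod_mul_distrib]
      exact Finset.prod_le_prod (fun m _ => hF0 m ξ) fun m hm => hbox' m hm ξ hξ
    calc pre ξ * (OUT ξ * ∏ m ∈ B, F m ξ) ≤ pre ξ * (OUT ξ * ((∏ m ∈ B, Real.exp (u m)) * ∏ m ∈ B, G m ξ)) :=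
          mul_le_mul_of_nonneg_left (mul_le_mul_of_nonneg_left hprod (hOUT0 ξ)) (hpre0 ξ)
      _ = (∏ m ∈ B, Real.exp (u m)) * (pre ξ * (OUT ξ * ∏ m ∈ B, G m ξ)) := by ring
  have hmeasG : Measurable fun ξ => pre ξ * (OUT ξ * ∏ m ∈ B, G m ξ) := by
    refine ((measurable_indicator_smallFieldOn _ I (1 * b)).mul (measurable_hamiltonian Γ).exp).mul
      ((measurable_integral_condField hα hβ Γ (measurable_indicator_smallFieldOn _ I b)).mul (Finset.measurable_prod _ fun m _ => ?_))
    exact measurable_integral_condField hα hβ Γ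
      (((measurable_indicator_smallFieldOn _ I (1 * b)).mul (measurable_indicator_smallFieldOn _ I b)).mul (measurable_psi1p_add_psi2 L w v m).exp)
  have hintG : Integrable (fun ξ => pre ξ * (OUT ξ * ∏ m ∈ B, G m ξ)) (P0 d α β) := by
    refine Integrable.of_bound hmeasG.aestronglyMeasurable
      (Real.exp (s1Const s D d κ * A * b ^ D * Γ.card) * (1 * ∏ _m ∈ B, Real.exp (8 * (s1Const s D d κ * A * b ^ D * (L : ℝ) ^ d))))
      (ae_of_all _ fun ξ => ?_)
    rw [Real.norm_eq_abs]
    have hp : |pre ξ| ≤ Real.exp (s1Const s D d κ * A * b ^ D * Γ.card) := abs_corridorObs_le hκ hJ hA0 hA hJI h1b hb Γ ξ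
    have hrest : |OUT ξ * ∏ m ∈ B, G m ξ| ≤ 1 * ∏ _m ∈ B, Real.exp (8 * (s1Const s D d κ * A * b ^ D * (L : ℝ) ^ d)) := by
      rw [abs_mul, Finset.abs_prod, abs_of_nonneg (hOUT0 ξ)]
      exact mul_le_mul (hOUT1 ξ) (Finset.prod_le_prod (fun m _ => abs_nonneg _) fun m _ => hKG m ξ)
        (Finset.prod_nonneg fun m _ => abs_nonneg _) zero_le_one
    calc |pre ξ * (OUT ξ * ∏ m ∈ B, G m ξ)| = |pre ξ| * |OUT ξ * ∏ m ∈ B, G m ξ| := abs_mul _ _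
      _ ≤ _ := mul_le_mul hp hrest (abs_nonneg _) (Real.exp_pos _).le
  have hU3 : ∫ ξ, pre ξ * (OUT ξ * ∏ m ∈ B, F m ξ) ∂P0 d α β
      ≤ Real.exp (∑ m ∈ B, u m) * ∫ ξ, pre ξ * (OUT ξ * ∏ m ∈ B, G m ξ) ∂P0 d α β := by
    rw [← integral_const_mul]
    exact integral_mono_of_nonneg (Filter.Eventually.of_forall fun ξ =>
      mul_nonneg (hpre0 ξ) (mul_nonneg (hOUT0 ξ) (Finset.prod_nonneg fun m _ => hF0 m ξ))) (hintG.const_mul _)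
      (Filter.Eventually.of_forall h3pt)
  -- U4: backwards at `γ = 1`, the (5.34) error upwards
  have hU4pt : ∀ z, IG z ≤ Real.exp e534 * cutoffBoltzmann (hamiltonian s D κ a (corridorsBar L w v B)) I b z := by
    intro z
    have hIGeq : IG z = ((smallFieldOn (Γ : Set (B1Eq324BenfattoLemma.Site d)) I (1 * b)).indicator (fun _ => (1 : ℝ)) z *
        ((smallFieldOn (out L B) I b).indicator (fun _ => (1 : ℝ)) z *
          ∏ m ∈ B, (smallFieldOn (shrink L m w : Set (B1Eq324BenfattoLemma.Site d)) I b).indicator (fun _ => (1 : ℝ)) z)) *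
        (∏ m ∈ B, (smallFieldOn (frame1 L w m : Set (B1Eq324BenfattoLemma.Site d)) I (1 * b)).indicator (fun _ => (1 : ℝ)) z) *
        Real.exp (hamiltonian s D κ a Γ z + ∑ m ∈ B, (psi1p s D κ a L w v m z + psi2 s D κ a L w m z)) := by
      simp only [hIG]
      rw [Real.exp_add, Real.exp_sum, Finset.prod_mul_distrib, Finset.prod_mul_distrib]
      ring
    rw [hIGeq, cutoffBoltzmann]
    have hP := prod_indicator_le_indicator_smallFieldSet L w B I (γ := 1) (b := b) le_rfl (zero_le_one.trans hb) z
    have hQ1 : ∏ m ∈ B, (smallFieldOn (frame1 L w m : Set (B1Eq324BenfattoLemma.Site d)) I (1 * b)).indicator (fun _ => (1 : ℝ)) z ≤ 1 :=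
      Finset.prod_le_one (fun m _ => (indicator_smallFieldOn_mem_Icc _ I _ z).1) fun m _ => (indicator_smallFieldOn_mem_Icc _ I _ z).2
    have hQ0 : 0 ≤ ∏ m ∈ B, (smallFieldOn (frame1 L w m : Set (B1Eq324BenfattoLemma.Site d)) I (1 * b)).indicator (fun _ => (1 : ℝ)) z :=
      Finset.prod_nonneg fun m _ => (indicator_smallFieldOn_mem_Icc _ I _ z).1
    by_cases hz : z ∈ smallFieldSet I b
    · rw [Set.indicator_of_mem hz, ← Real.exp_add]
      have h534 := abs_hamiltonian_corridorsBar_sub_sum_psi_le hκ hJ hA0 hA hL hv hb (hzJ z hz) (B := B) (s := s) (D := D)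
      have hexp : Real.exp (hamiltonian s D κ a Γ z + ∑ m ∈ B, (psi1p s D κ a L w v m z + psi2 s D κ a L w m z))
          ≤ Real.exp (e534 + hamiltonian s D κ a (corridorsBar L w v B) z) := by
        rw [Real.exp_le_exp]
        have := (abs_le.mp h534).1
        simp only [he534]
        linarith
      have hPQ : (smallFieldOn (Γ : Set (B1Eq324BenfattoLemma.Site d)) I (1 * b)).indicator (fun _ => (1 : ℝ)) z *
          ((smallFieldOn (out L B) I b).indicator (fun _ => (1 : ℝ)) z *
            ∏ m ∈ B, (smallFieldOn (shrink L m w : Set (B1Eq324BenfattoLemma.Site d)) I b).indicator (fun _ => (1 : ℝ)) z) *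
          (∏ m ∈ B, (smallFieldOn (frame1 L w m : Set (B1Eq324BenfattoLemma.Site d)) I (1 * b)).indicator (fun _ => (1 : ℝ)) z) ≤ 1 := by
        rw [Set.indicator_of_mem hz] at hP
        exact mul_le_one₀ hP hQ0 hQ1
      calc _ ≤ 1 * Real.exp (e534 + hamiltonian s D κ a (corridorsBar L w v B) z) :=
            mul_le_mul hPQ hexp (Real.exp_pos _).le zero_le_one
        _ = _ := by rw [one_mul]
    · rw [Set.indicator_of_notMem hz] at hP ⊢
      rw [mul_zero]
      have h0 : (smallFieldOn (Γ : Set (B1Eq324BenfattoLemma.Site d)) I (1 * b)).indicator (fun _ => (1 : ℝ)) z *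
          ((smallFieldOn (out L B) I b).indicator (fun _ => (1 : ℝ)) z *
            ∏ m ∈ B, (smallFieldOn (shrink L m w : Set (B1Eq324BenfattoLemma.Site d)) I b).indicator (fun _ => (1 : ℝ)) z) = 0 :=
        le_antisymm hP (mul_nonneg (indicator_smallFieldOn_mem_Icc _ I _ z).1 (mul_nonneg (indicator_smallFieldOn_mem_Icc _ I _ z).1
          (Finset.prod_nonneg fun m _ => (indicator_smallFieldOn_mem_Icc _ I _ z).1)))
      rw [h0, zero_mul, zero_mul]
  have hZint : Integrable (fun z => cutoffBoltzmann (hamiltonian s D κ a (corridorsBar L w v B)) I b z) (P0 d α β) := by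
    refine Integrable.of_bound (measurable_cutoffBoltzmann_hamiltonian a _ I b).aestronglyMeasurable
      (Real.exp (s1Const s D d κ * A * b ^ D * (corridorsBar L w v B).card)) (ae_of_all _ fun z => ?_)
    rw [Real.norm_eq_abs, cutoffBoltzmann]
    by_cases hz : z ∈ smallFieldSet I b
    · rw [Set.indicator_of_mem hz, Real.abs_exp, Real.exp_le_exp]
      exact (le_abs_self _).trans (abs_hamiltonian_le hκ hJ hA0 hA _ hb (hzJ z hz))
    · rw [Set.indicator_of_notMem hz, abs_zero]
      exact (Real.exp_pos _).le
  have hU4 : ∫ z, IG z ∂P0 d α β ≤ Real.exp e534 * ∫ z, cutoffBoltzmann (hamiltonian s D κ a (corridorsBar L w v B)) I b z ∂P0 d α β := by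
    rw [← integral_const_mul]
    refine integral_mono_of_nonneg (Filter.Eventually.of_forall fun z => ?_) (hZint.const_mul _) (Filter.Eventually.of_forall hU4pt)
    exact mul_nonneg (mul_nonneg (indicator_smallFieldOn_mem_Icc _ I _ z).1 (Real.exp_pos _).le)
      (mul_nonneg (indicator_smallFieldOn_mem_Icc _ I _ z).1 (Finset.prod_nonneg fun m _ =>
        hboxObs0 m (fun z => psi1p s D κ a L w v m z + psi2 s D κ a L w m z) z))
  -- U5: the next datum
  have h5 : ∫ z, cutoffBoltzmann (hamiltonian s D κ a (corridorsBar L w v B)) I b z ∂P0 d α β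
      = ∫ z, cutoffBoltzmann (hamiltonian s D κ (restrictCoef a (corridorsBar L w v B)) (J ∩ corridorsBar L w v B)) I b z ∂P0 d α β :=
    integral_congr_ae (Filter.Eventually.of_forall fun z => cutoffBoltzmann_hamiltonian_eq_restrict hJ _ I b z)
  -- chain
  rw [← h5]
  calc ∫ z, cutoffBoltzmann (hamiltonian s D κ a J) I b z ∂P0 d α β ≤ Real.exp e511 * ∫ z, IF z ∂P0 d α β := hU12
    _ = Real.exp e511 * ∫ ξ, pre ξ * (OUT ξ * ∏ m ∈ B, F m ξ) ∂P0 d α β := by rw [hfacF]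
    _ ≤ Real.exp e511 * (Real.exp (∑ m ∈ B, u m) * ∫ ξ, pre ξ * (OUT ξ * ∏ m ∈ B, G m ξ) ∂P0 d α β) :=
        mul_le_mul_of_nonneg_left hU3 (Real.exp_pos _).le
    _ = Real.exp e511 * (Real.exp (∑ m ∈ B, u m) * ∫ z, IG z ∂P0 d α β) := by rw [hfacG]
    _ ≤ Real.exp e511 * (Real.exp (∑ m ∈ B, u m) *
          (Real.exp e534 * ∫ z, cutoffBoltzmann (hamiltonian s D κ a (corridorsBar L w v B)) I b z ∂P0 d α β)) :=
        mul_le_mul_of_nonneg_left (mul_le_mul_of_nonneg_left hU4 (Real.exp_pos _).le) (Real.exp_pos _).le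
    _ = _ := by
        rw [show e511 + e534 + ∑ m ∈ B, u m = e511 + (∑ m ∈ B, u m + e534) by ring, Real.exp_add, Real.exp_add]
        ring

end Upper

end Literature.MathematicalPhysics.QuantumFieldTheory.Balaban1983to89.B1Eq324BenfattoSect5PavementStep

end
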